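import Literature.NumberTheory.EllipticCurves.GrossPointsThetaElement
import Mathlib.RingTheory.AdjoinRoot
import Mathlib.RingTheory.OrzechProperty
import Mathlib.RingTheory.FiniteType
import Mathlib.GroupTheory.SpecificGroups.Cyclic
import HarnessLib

/-!
# The group ring `ℤ_p[G]` of a finite cyclic `p`-group as `ℤ_p[X]/(ω_e)`, `ω_e = (X+1)^{p^e} − 1`

Route-independent `Theorems` file (cell `b2b-bsdres`, seat `b2b-bsdres-x10b`, gen 44), part 1 of the series «tower square root»
serving crux `DerivedHeightCap` (stmt-BirchSwinnertonDyer-18438, route DefiniteTheta), registered stub `stub_towerSqrt`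
("pure Iwasawa algebra: if `θ_n θ_n^* ∈ I_n^{2ρ}` along a norm-compatible tower then `θ_n ∈ I_n^ρ`").
HONEST FRAMING: no curve asserted, no class closed, BSD not proved by any of this.

For a commutative group `G` generated by an element `γ` with `γ^{p^e} = 1` and `Nat.card G = p^e`
(Washington, *Cyclotomic Fields*, §7.1: `ℤ_p[Γ_n] ≅ ℤ_p[T]/((1+T)^{p^n} − 1)`, `γ ↦ 1 + T`):

* §1 `ω_e := (X + 1)^{p^e} − 1 ∈ ℤ_p[X]` (written out in every statement; no definition is introduced) is monic of degree
  `p^e` with `coeff_0 = 0`, `coeff_i = C(p^e, i)`;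
* §2 the evaluation `aeval (γ − 1) : ℤ_p[X] →ₐ ℤ_p[G]`, `X ↦ γ − 1` (Mathlib `Polynomial.aeval`; "`evalGen`" and "`omegaPoly`" survive
  only inside lemma NAMES), is onto (`evalGen_surjective`), kills `ω_e` (`evalGen_omegaPoly`), is compatible with group maps (`mapDomainRingHom_evalGen`: `π_* ∘ evalGen γ = evalGen (π γ)`) and with the augmentation (`augmentation_evalGen`:
  `ε (evalGen γ F) = F(0)`);
* §3 its kernel is EXACTLY `(ω_e)` (`omegaPoly_dvd_of_evalGen_eq_zero`: the induced `ℤ_p[X]/(ω_e) → ℤ_p[G]` is onto, and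
  one-to-one since both sides are finite free `ℤ_p`-modules of the same rank `p^e` — Orzech property);
* §4 the augmentation ideal (tree: `Literature.NumberTheory.EllipticCurves.augIdeal`) of `R[G]` for `G` generated by `γ` is
  principal, `I = (γ − 1)` (`augIdeal_eq_span_of_gen`), hence `I^ρ = ((γ−1)^ρ)`; and the involution `ι = (σ ↦ σ⁻¹)_*`
  maps `I^ρ` into `I^ρ` (`mapDomain_inv_mem_augIdeal_pow`).

## References
* [Washington1997] L. C. Washington, *Introduction to Cyclotomic Fields*, 2nd ed., GTM 83, §7.1, Thm. 7.1, Prop. 7.2.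
* [BertoliniDarmon2005] M. Bertolini, H. Darmon, Ann. of Math. 162 (2005), §1.2 (18)–(21).
-/

noncomputable section

open scoped BigOperators Polynomial

-- D-0017: single-problem summit, the namespace repeats the problem name by design.
set_option linter.dupNamespace false

namespace Summit.BirchSwinnertonDyer.BirchSwinnertonDyer.Theorems.TowerSqrt

open Literature.NumberTheory.EllipticCurves (augIdeal augmentation augmentation_single mem_augIdeal_iff map_augIdeal_pow_le
  augmentation_comp_mapDomainRingHom)

variable (p : ℕ) [hp : Fact p.Prime]

/-! ### §1 The polynomials `ω_e = (X+1)^{p^e} − 1` -/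

/-- `natDegree ((X+1)^{p^e}) = p^e`. [folklore] -/
theorem natDegree_X_add_one_pow (e : ℕ) : ((Polynomial.X + 1 : ℤ_[p][X]) ^ (p ^ e)).natDegree = p ^ e := by
  have h1 : (Polynomial.X + 1 : ℤ_[p][X]).natDegree = 1 := by
    simpa using Polynomial.natDegree_X_add_C (1 : ℤ_[p])
  rw [Polynomial.natDegree_pow, h1, mul_one]

/-- `degree 1 < degree ((X+1)^{p^e})`. [folklore] -/
theorem degree_one_lt (e : ℕ) : (1 : ℤ_[p][X]).degree < ((Polynomial.X + 1 : ℤ_[p][X]) ^ (p ^ e)).degree := by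
  have hne : ((Polynomial.X + 1 : ℤ_[p][X]) ^ (p ^ e)) ≠ 0 :=
    pow_ne_zero _ (Polynomial.X_add_C_ne_zero (1 : ℤ_[p]))
  rw [Polynomial.degree_one, Polynomial.degree_eq_natDegree hne, natDegree_X_add_one_pow]
  exact_mod_cast pow_pos hp.out.pos e

/-- `ω_e` is monic. [folklore] -/
theorem omegaPoly_monic (e : ℕ) : (((Polynomial.X + 1 : ℤ_[p][X]) ^ (p ^ e) - 1)).Monic :=
  ((Polynomial.monic_X_add_C (1 : ℤ_[p])).pow (p ^ e)).sub_of_left (degree_one_lt p e)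

/-- `natDegree ω_e = p^e`. [folklore] -/
theorem natDegree_omegaPoly (e : ℕ) : (((Polynomial.X + 1 : ℤ_[p][X]) ^ (p ^ e) - 1)).natDegree = p ^ e := by
  have h : (1 : ℤ_[p][X]).natDegree < ((Polynomial.X + 1 : ℤ_[p][X]) ^ (p ^ e)).natDegree := by
    rw [Polynomial.natDegree_one, natDegree_X_add_one_pow]; exact pow_pos hp.out.pos e
  rw [Polynomial.natDegree_sub_eq_left_of_natDegree_lt h, natDegree_X_add_one_pow]

/-- The lower coefficients of `ω_e`: `coeff ω_e 0 = 0` and `coeff ω_e i = C(p^e, i)` for `0 < i`. [folklore] -/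
theorem coeff_omegaPoly (e i : ℕ) :
    (((Polynomial.X + 1 : ℤ_[p][X]) ^ (p ^ e) - 1)).coeff i = if i = 0 then 0 else (((p ^ e).choose i : ℕ) : ℤ_[p]) := by
  rw [Polynomial.coeff_sub, Polynomial.coeff_X_add_one_pow, Polynomial.coeff_one]
  by_cases h : i = 0
  · subst h; simp
  · simp [h]

/-! ### §2 The evaluation `X ↦ γ − 1` -/

variable {G : Type*} [CommGroup G]

/-- `evalGen γ (C c) = single 1 c` (the scalars). [folklore] -/
@[simp] theorem evalGen_C (γ : G) (c : ℤ_[p]) : (Polynomial.aeval (R := ℤ_[p]) (MonoidAlgebra.of ℤ_[p] _ γ - 1)) (Polynomial.C c) = MonoidAlgebra.single 1 c := by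
  rw [Polynomial.aeval_C]
  rfl

/-- `evalGen γ ((X+1)^k) = γ^k`. [folklore] -/
theorem evalGen_X_add_one_pow (γ : G) (k : ℕ) :
    (Polynomial.aeval (R := ℤ_[p]) (MonoidAlgebra.of ℤ_[p] _ γ - 1)) ((Polynomial.X + 1) ^ k) = MonoidAlgebra.of ℤ_[p] G (γ ^ k) := by
  rw [map_pow, map_add, map_one, Polynomial.aeval_X, sub_add_cancel, map_pow]

/-- `evalGen γ (ω_e) = 0` when `γ^{p^e} = 1`. [cite: Washington1997, §7.1] -/
theorem evalGen_omegaPoly (γ : G) (e : ℕ) (hγ : γ ^ (p ^ e) = 1) : (Polynomial.aeval (R := ℤ_[p]) (MonoidAlgebra.of ℤ_[p] _ γ - 1)) (((Polynomial.X + 1 : ℤ_[p][X]) ^ (p ^ e) - 1)) = 0 := by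
  rw [map_sub, evalGen_X_add_one_pow, hγ, map_one, map_one]
  exact sub_self _

/-- **`evalGen γ` is onto when `γ` generates `G`** (every `σ = γ^k` is `evalGen ((X+1)^k)`). [cite: Washington1997, §7.1] -/
theorem evalGen_surjective (γ : G) (hgen : ∀ g : G, ∃ k : ℕ, γ ^ k = g) :
    Function.Surjective ((Polynomial.aeval (R := ℤ_[p]) (MonoidAlgebra.of ℤ_[p] _ γ - 1))) := by
  intro f
  induction f using MonoidAlgebra.induction_linear with
  | zero => exact ⟨0, map_zero _⟩
  | add f g hf hg =>
    obtain ⟨a, ha⟩ := hf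
    obtain ⟨b, hb⟩ := hg
    exact ⟨a + b, by rw [map_add, ha, hb]⟩
  | single σ c =>
    obtain ⟨k, hk⟩ := hgen σ
    refine ⟨Polynomial.C c * (Polynomial.X + 1) ^ k, ?_⟩
    rw [map_mul, evalGen_X_add_one_pow, hk, evalGen_C, MonoidAlgebra.of_apply,
      MonoidAlgebra.single_mul_single, one_mul, mul_one]

/-- **Compatibility with group maps**: `π_* (evalGen γ F) = evalGen (π γ) F` for a homomorphism `π : G → H`
(both sides are `ℤ_p`-algebra maps `ℤ_p[X] → ℤ_p[H]` agreeing on `X`). [folklore] -/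
theorem mapDomainRingHom_evalGen {H : Type*} [CommGroup H] (π : G →* H) (γ : G) (F : ℤ_[p][X]) :
    MonoidAlgebra.mapDomainRingHom ℤ_[p] π ((Polynomial.aeval (R := ℤ_[p]) (MonoidAlgebra.of ℤ_[p] _ γ - 1)) F) = (Polynomial.aeval (R := ℤ_[p]) (MonoidAlgebra.of ℤ_[p] _ (π γ) - 1)) F := by
  have h : (MonoidAlgebra.mapDomainAlgHom ℤ_[p] ℤ_[p] π).comp ((Polynomial.aeval (R := ℤ_[p]) (MonoidAlgebra.of ℤ_[p] _ γ - 1))) = (Polynomial.aeval (R := ℤ_[p]) (MonoidAlgebra.of ℤ_[p] _ (π γ) - 1)) := by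
    refine Polynomial.algHom_ext ?_
    rw [AlgHom.comp_apply, Polynomial.aeval_X, Polynomial.aeval_X, map_sub, map_one, MonoidAlgebra.mapDomainAlgHom_apply,
      MonoidAlgebra.of_apply, MonoidAlgebra.of_apply, MonoidAlgebra.mapDomain_single]
  have := congrArg (fun φ => φ F) h
  simpa only [AlgHom.comp_apply, MonoidAlgebra.mapDomainAlgHom_apply, MonoidAlgebra.mapDomainRingHom_apply] using this

/-- **Compatibility with the augmentation**: `ε (evalGen γ F) = F(0) = coeff_0 F` (`ε(γ − 1) = 0`). [folklore] -/
theorem augmentation_evalGen (γ : G) (F : ℤ_[p][X]) : augmentation ℤ_[p] G ((Polynomial.aeval (R := ℤ_[p]) (MonoidAlgebra.of ℤ_[p] _ γ - 1)) F) = F.coeff 0 := by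
  rw [← Polynomial.aeval_algHom_apply, map_sub, map_one, MonoidAlgebra.of_apply, augmentation_single, sub_self,
    Polynomial.coeff_zero_eq_aeval_zero]

/-- `ε (ι θ) = ε θ` for the involution `ι = (σ ↦ σ⁻¹)_*`. [folklore] -/
theorem augmentation_mapDomain_inv (R : Type*) [CommRing R] (θ : MonoidAlgebra R G) :
    augmentation R G (MonoidAlgebra.mapDomain (fun σ : G => σ⁻¹) θ) = augmentation R G θ := by
  have hfun : MonoidAlgebra.mapDomain (fun σ : G => σ⁻¹) θ =
      MonoidAlgebra.mapDomainRingHom R (invMonoidHom : G →* G) θ := rfl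
  have := RingHom.congr_fun (augmentation_comp_mapDomainRingHom R G (invMonoidHom : G →* G)) θ
  rw [RingHom.comp_apply, RingHom.coe_coe] at this
  rw [hfun, this]

/-! ### §3 The kernel of `evalGen γ` is `(ω_e)` -/

/-- **`ℤ_p[X]/(ω_e) ≅ ℤ_p[G]`, i.e. `ker (X ↦ γ − 1) = (ω_e)`**: `F(γ − 1) = 0 ⇒ ω_e ∣ F` when `γ` generates `G` and
`#G = p^e` (the induced map `ℤ_p[X]/(ω_e) → ℤ_p[G]` is onto by §2 and one-to-one since both sides are free of rank `p^e`
over `ℤ_p` and commutative rings have the Orzech property). [cite: Washington1997, §7.1] -/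
theorem omegaPoly_dvd_of_evalGen_eq_zero [Finite G] (γ : G) (e : ℕ) (hγ : γ ^ (p ^ e) = 1)
    (hgen : ∀ g : G, ∃ k : ℕ, γ ^ k = g) (hcard : Nat.card G = p ^ e) {f : ℤ_[p][X]}
    (hf : (Polynomial.aeval (R := ℤ_[p]) (MonoidAlgebra.of ℤ_[p] _ γ - 1)) f = 0) : ((Polynomial.X + 1 : ℤ_[p][X]) ^ (p ^ e) - 1) ∣ f := by
  classical
  letI : Fintype G := Fintype.ofFinite G
  -- the induced map on `AdjoinRoot ω_e = ℤ_p[X]/(ω_e)`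
  let L : AdjoinRoot (((Polynomial.X + 1 : ℤ_[p][X]) ^ (p ^ e) - 1)) →ₐ[ℤ_[p]] MonoidAlgebra ℤ_[p] G :=
    AdjoinRoot.liftAlgHom (((Polynomial.X + 1 : ℤ_[p][X]) ^ (p ^ e) - 1)) (Algebra.ofId ℤ_[p] (MonoidAlgebra ℤ_[p] G)) (MonoidAlgebra.of ℤ_[p] G γ - 1)
      (by
        have h := evalGen_omegaPoly p γ e hγ
        rwa [Polynomial.aeval_def] at h)
  have hL : ∀ g : ℤ_[p][X], L (AdjoinRoot.mk _ g) = (Polynomial.aeval (R := ℤ_[p]) (MonoidAlgebra.of ℤ_[p] _ γ - 1)) g := fun g => by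
    simp only [L]
    rw [AdjoinRoot.liftAlgHom_mk, Polynomial.aeval_def]
    rfl
  have hsurj : Function.Surjective L := by
    intro x
    obtain ⟨a, ha⟩ := evalGen_surjective p γ hgen x
    exact ⟨AdjoinRoot.mk _ a, by rw [hL, ha]⟩
  -- both sides are finite free `ℤ_p`-modules of rank `p^e`: `L` is injective (Orzech property)
  let bQ : Module.Basis (Fin (((Polynomial.X + 1 : ℤ_[p][X]) ^ (p ^ e) - 1)).natDegree) ℤ_[p] (AdjoinRoot (((Polynomial.X + 1 : ℤ_[p][X]) ^ (p ^ e) - 1))) :=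
    (AdjoinRoot.powerBasis' (omegaPoly_monic p e)).basis
  let bG : Module.Basis G ℤ_[p] (MonoidAlgebra ℤ_[p] G) := MonoidAlgebra.basis G ℤ_[p]
  have hcard' : Fintype.card (Fin (((Polynomial.X + 1 : ℤ_[p][X]) ^ (p ^ e) - 1)).natDegree) = Fintype.card G := by
    rw [Fintype.card_fin, natDegree_omegaPoly, ← hcard, Nat.card_eq_fintype_card]
  let ε : Fin (((Polynomial.X + 1 : ℤ_[p][X]) ^ (p ^ e) - 1)).natDegree ≃ G := Fintype.equivOfCardEq hcard'
  let i : AdjoinRoot (((Polynomial.X + 1 : ℤ_[p][X]) ^ (p ^ e) - 1)) ≃ₗ[ℤ_[p]] MonoidAlgebra ℤ_[p] G := bQ.equiv bG ε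
  haveI : Module.Finite ℤ_[p] (MonoidAlgebra ℤ_[p] G) := Module.Finite.of_basis bG
  have hinj : Function.Injective L :=
    OrzechProperty.injective_of_surjective_of_injective i.toLinearMap L.toLinearMap i.injective hsurj
  have h0 : L (AdjoinRoot.mk _ f) = L 0 := by rw [hL, hf, map_zero]
  exact AdjoinRoot.mk_eq_zero.mp (hinj h0)

/-! ### §4 The augmentation ideal of `R[G]` for `G` generated by `γ` is `(γ − 1)` -/

section Aug

variable (R : Type*) [CommRing R]

omit hp in
/-- `ε θ` as the sum of the coefficients… in the form `θ − (ε θ)·1 ∈ (γ − 1)` for every `θ ∈ R[G]`, `G` generated by `γ`: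
on generators, `c σ − c·1 = (c·1)(γ^k − 1)` and `γ − 1 ∣ γ^k − 1`. [folklore] -/
theorem sub_single_augmentation_mem_span (γ : G) (hgen : ∀ g : G, ∃ k : ℕ, γ ^ k = g) (θ : MonoidAlgebra R G) :
    θ - MonoidAlgebra.single 1 (augmentation R G θ) ∈ Ideal.span {MonoidAlgebra.of R G γ - 1} := by
  induction θ using MonoidAlgebra.induction_linear with
  | zero => simp
  | add x y hx hy =>
    have : x + y - MonoidAlgebra.single 1 (augmentation R G (x + y)) =
        (x - MonoidAlgebra.single 1 (augmentation R G x)) + (y - MonoidAlgebra.single 1 (augmentation R G y)) := by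
      rw [map_add, MonoidAlgebra.single_add]; abel
    rw [this]
    exact Ideal.add_mem _ hx hy
  | single σ c =>
    obtain ⟨k, hk⟩ := hgen σ
    rw [augmentation_single]
    have h1 : MonoidAlgebra.single σ c - MonoidAlgebra.single (1 : G) c =
        MonoidAlgebra.single (1 : G) c * ((MonoidAlgebra.of R G γ) ^ k - 1) := by
      rw [← map_pow, MonoidAlgebra.of_apply, hk, mul_sub, MonoidAlgebra.single_mul_single, one_mul, mul_one, mul_one]
    rw [h1]
    refine Ideal.mul_mem_left _ _ (Ideal.mem_span_singleton.mpr ?_)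
    simpa using sub_dvd_pow_sub_pow (MonoidAlgebra.of R G γ) 1 k

omit hp in
/-- **`I = (γ − 1)`** for `G` generated by `γ` (Washington §7.1: the augmentation ideal of `ℤ_p[Γ_n]` corresponds to `(T)`).
[cite: Washington1997, §7.1] -/
theorem augIdeal_eq_span_of_gen (γ : G) (hgen : ∀ g : G, ∃ k : ℕ, γ ^ k = g) :
    augIdeal R G = Ideal.span {MonoidAlgebra.of R G γ - 1} := by
  apply le_antisymm
  · intro θ hθ
    rw [mem_augIdeal_iff] at hθ
    have h := sub_single_augmentation_mem_span R γ hgen θ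
    rwa [hθ, MonoidAlgebra.single_zero, sub_zero] at h
  · rw [Ideal.span_le, Set.singleton_subset_iff, SetLike.mem_coe, mem_augIdeal_iff, map_sub, map_one,
      MonoidAlgebra.of_apply, augmentation_single, sub_self]

omit hp in
/-- Hence `I^ρ = ((γ − 1)^ρ)`. [folklore] -/
theorem augIdeal_pow_eq_span_of_gen (γ : G) (hgen : ∀ g : G, ∃ k : ℕ, γ ^ k = g) (ρ : ℕ) :
    augIdeal R G ^ ρ = Ideal.span {(MonoidAlgebra.of R G γ - 1) ^ ρ} := by
  rw [augIdeal_eq_span_of_gen R γ hgen, Ideal.span_singleton_pow]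

omit hp in
/-- **The involution `ι : σ ↦ σ⁻¹` preserves `I^ρ`**: `ι` is the ring map `mapDomainRingHom` of the inversion homomorphism
(commutative `G`) and `ε ∘ ι = ε` (`map_augIdeal_pow_le` of the tree). [folklore] -/
theorem mapDomain_inv_mem_augIdeal_pow (ρ : ℕ) {θ : MonoidAlgebra R G} (hθ : θ ∈ augIdeal R G ^ ρ) :
    MonoidAlgebra.mapDomain (fun σ => σ⁻¹) θ ∈ augIdeal R G ^ ρ := by
  have hfun : MonoidAlgebra.mapDomain (fun σ : G => σ⁻¹) θ =
      MonoidAlgebra.mapDomainRingHom R (invMonoidHom : G →* G) θ := rfl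
  rw [hfun]
  exact map_augIdeal_pow_le R G (invMonoidHom : G →* G) ρ (Ideal.mem_map_of_mem _ hθ)

omit hp in
/-- `ι` is an involution on `R[G]`. [folklore] -/
theorem mapDomain_inv_mapDomain_inv (θ : MonoidAlgebra R G) :
    MonoidAlgebra.mapDomain (fun σ : G => σ⁻¹) (MonoidAlgebra.mapDomain (fun σ : G => σ⁻¹) θ) = θ := by
  induction θ using MonoidAlgebra.induction_linear with
  | zero => simp [MonoidAlgebra.mapDomain_zero]
  | add x y hx hy => rw [MonoidAlgebra.mapDomain_add, MonoidAlgebra.mapDomain_add, hx, hy]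
  | single σ c => rw [MonoidAlgebra.mapDomain_single, MonoidAlgebra.mapDomain_single, inv_inv]

end Aug

end Summit.BirchSwinnertonDyer.BirchSwinnertonDyer.Theorems.TowerSqrt

end
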